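import Summits.Schanuel.Schanuel.Theorems.ZilberEacBranchPoleFibrePoints
import HarnessLib

/-!
# Arbitrary base branches, LXXIV(a): asymptotics of the pole-fibre points — the unit factor `u_n`
# is `1 + O(log n / n)`, and polynomial perturbation at that scale

HONEST FRAMING.  Cell `pub-schanuel` (Zilber's Exponential-Algebraic Closedness, case ladder;
host summit Schanuel), seat 2, gen 32.  File XXXI produces the exponential points of a pole /
zero fibre value `y₀ = ψ(s)s^L` along a place `x₀ = s^{-k}`: `s_n = z^{-1} e^{-(log n)/k} u_n`
with `u_n = exp(−log(1 + ε_n)/k)`, `ε_n = (−(L/k) log n + w_n)/(2πi n)`, `‖w_n‖ ≤ W`.  Files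
XXXII / LXXI used only `u_n → 1`.  To let the SUBLEADING Puiseux terms `φ_i s^{i−k}`
(`0 < i < k`) of the second coordinate enter (file LXXIV(b)), one needs the rate:
* **`tendsto_mul_add_div_exp`** — `(Aℓ + B)/e^{κℓ} → 0` along `ℓ_m → ∞` (`κ > 0`);
* **`tendsto_exp_pow_mul_norm_inv_sub_one`** — `e^{dℓ_n/k}·‖u_n^{-1} − 1‖ → 0` for every
  `d < k` (`ℓ_n = log n`): `‖u_n^{-1} − 1‖ ≤ 3‖ε_n‖ = O(log n / n)` beats every power `n^{d/k}`,
  `d < k`;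
* **`tendsto_eval_mul_sub_eval`** — polynomial perturbation: `Q(a_m v_m) − Q(a_m) → 0` when
  `deg Q ≤ d`, `a_m ≥ 1`, `‖v_m‖ ≤ 2` and `a_m^d ‖v_m − 1‖ → 0`.
[folklore analysis]; nothing here is specific to Schanuel's conjecture (neither used nor implied);
Mantova–Masser's question (PLMS 2024 §1 p. 5) and EC(3,2) stay OPEN.
-/

noncomputable section

open Filter Topology Metric Complex Polynomial

set_option linter.dupNamespace false

namespace Summit.Schanuel.Schanuel.Theorems

/-! ## Part A. Two elementary limits -/

/-- `(A·ℓ_m + B) / e^{κ ℓ_m} → 0` when `ℓ_m → ∞` and `κ > 0`. [folklore] -/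
theorem tendsto_mul_add_div_exp {ℓ : ℕ → ℝ} (hℓ : Tendsto ℓ atTop atTop) {κ : ℝ} (hκ : 0 < κ)
    (A B : ℝ) : Tendsto (fun m => (A * ℓ m + B) / Real.exp (κ * ℓ m)) atTop (𝓝 0) := by
  have hκℓ : Tendsto (fun m => κ * ℓ m) atTop atTop := hℓ.const_mul_atTop hκ
  have h1 : Tendsto (fun m => (κ * ℓ m) ^ 1 * Real.exp (-(κ * ℓ m))) atTop (𝓝 0) :=
    (Real.tendsto_pow_mul_exp_neg_atTop_nhds_zero 1).comp hκℓ
  have h2 : Tendsto (fun m => Real.exp (-(κ * ℓ m))) atTop (𝓝 0) :=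
    Real.tendsto_exp_neg_atTop_nhds_zero.comp hκℓ
  have h := (h1.const_mul (A / κ)).add (h2.const_mul B)
  rw [mul_zero, mul_zero, add_zero] at h
  refine h.congr fun m => ?_
  rw [pow_one, Real.exp_neg]
  field_simp

/-- `log n / n`-type decay beats `n^{d/k}` for `d < k`: with `ℓ_m = log(N₀ + m)`,
`e^{dℓ_m/k}·(Aℓ_m + B)/(N₀ + m) → 0`. [folklore] -/
theorem tendsto_exp_pow_mul_div_label {N₀ : ℕ} (hN₀ : 1 ≤ N₀) {k d : ℕ} (hk : 1 ≤ k) (hd : d < k)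
    (A B : ℝ) :
    Tendsto (fun m => Real.exp (Real.log ((N₀ + m : ℕ) : ℝ) / k) ^ d *
      ((A * Real.log ((N₀ + m : ℕ) : ℝ) + B) / ((N₀ + m : ℕ) : ℝ))) atTop (𝓝 0) := by
  set ℓ : ℕ → ℝ := fun m => Real.log ((N₀ + m : ℕ) : ℝ) with hℓ
  have hnpos : ∀ m, (0 : ℝ) < ((N₀ + m : ℕ) : ℝ) := fun m => by
    have : (1 : ℝ) ≤ ((N₀ + m : ℕ) : ℝ) := by exact_mod_cast (show 1 ≤ N₀ + m by omega)
    linarith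
  have hℓt : Tendsto ℓ atTop atTop := by
    rw [hℓ]
    refine Real.tendsto_log_atTop.comp (tendsto_natCast_atTop_atTop.comp ?_)
    exact (tendsto_add_atTop_nat N₀).congr fun m => by omega
  have hkR : (0 : ℝ) < k := by exact_mod_cast (show 0 < k by omega)
  have hκ : (0 : ℝ) < ((k : ℝ) - d) / k := by
    have : (d : ℝ) < k := by exact_mod_cast hd
    exact div_pos (by linarith) hkR
  refine (tendsto_mul_add_div_exp hℓt hκ A B).congr fun m => ?_
  show (A * ℓ m + B) / Real.exp (((k : ℝ) - d) / k * ℓ m) =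
    Real.exp (ℓ m / k) ^ d * ((A * ℓ m + B) / ((N₀ + m : ℕ) : ℝ))
  have hn' : ((N₀ + m : ℕ) : ℝ) =
      Real.exp ((d : ℝ) * (ℓ m / k)) * Real.exp (((k : ℝ) - d) / k * ℓ m) := by
    rw [← Real.exp_add, ← Real.exp_log (hnpos m)]
    congr 1
    show ℓ m = _
    field_simp
    ring
  have e2 : Real.exp (ℓ m / k) ^ d = Real.exp ((d : ℝ) * (ℓ m / k)) := by
    rw [← Real.exp_nat_mul]
  rw [e2, hn']
  have h1 : Real.exp ((d : ℝ) * (ℓ m / k)) ≠ 0 := (Real.exp_pos _).ne'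
  field_simp

/-! ## Part B. The rate of the unit factor -/

/-- **The unit factor of file XXXI is `1 + O(log n/n)`.**  With `u_n = exp(−log(1 + ε_n)/k)`,
`ε_n = (−(L/k)·log n + w_n)/(n·2πi)`, `‖w_n‖ ≤ W`: `e^{d(log n)/k}·‖u_n^{-1} − 1‖ → 0` for every
`d < k`. [folklore] -/
theorem tendsto_exp_pow_mul_norm_inv_sub_one {k : ℕ} (hk : 1 ≤ k) (L : ℤ) {N₀ : ℕ} (hN₀ : 1 ≤ N₀)
    {u w : ℕ → ℂ} {W : ℝ} (hw : ∀ j, ‖w j‖ ≤ W)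
    (hu : ∀ j, u j = Complex.exp (-(Complex.log (1 + ((-(L : ℂ) / k) *
      (Real.log ((N₀ + j : ℕ) : ℝ) : ℂ) + w j) / (((N₀ + j : ℕ) : ℂ) * (2 * Real.pi * I)))) / k))
    {d : ℕ} (hd : d < k) :
    Tendsto (fun j => Real.exp (Real.log ((N₀ + j : ℕ) : ℝ) / k) ^ d * ‖(u j)⁻¹ - 1‖)
      atTop (𝓝 0) := by
  set ℓ : ℕ → ℝ := fun j => Real.log ((N₀ + j : ℕ) : ℝ) with hℓ
  set ε : ℕ → ℂ := fun j => ((-(L : ℂ) / k) * (ℓ j : ℂ) + w j) /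
    (((N₀ + j : ℕ) : ℂ) * (2 * Real.pi * I)) with hε
  have hk0 : (k : ℝ) ≠ 0 := by exact_mod_cast (show k ≠ 0 by omega)
  have hk1 : (1 : ℝ) ≤ k := by exact_mod_cast hk
  have hn1 : ∀ j, (1 : ℝ) ≤ ((N₀ + j : ℕ) : ℝ) := fun j => by
    exact_mod_cast (show 1 ≤ N₀ + j by omega)
  have hℓ0 : ∀ j, 0 ≤ ℓ j := fun j => Real.log_nonneg (hn1 j)
  have hW0 : 0 ≤ W := (norm_nonneg _).trans (hw 0)
  -- `u⁻¹ = exp(log(1 + ε)/k)`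
  have huinv : ∀ j, (u j)⁻¹ = Complex.exp (Complex.log (1 + ε j) / k) := by
    intro j
    rw [hu j, neg_div, Complex.exp_neg, inv_inv]
  -- `‖ε_j‖ ≤ ((|L|/k)ℓ_j + W)/(2π n_j)`
  have hεle : ∀ j, ‖ε j‖ ≤ ((|(L : ℝ)| / k) * ℓ j + W) / (2 * Real.pi * ((N₀ + j : ℕ) : ℝ)) := by
    intro j
    have hnpos : (0 : ℝ) < ((N₀ + j : ℕ) : ℝ) := by linarith [hn1 j]
    rw [hε, norm_div, norm_mul, Complex.norm_natCast]
    have hden : ‖(2 * Real.pi * I : ℂ)‖ = 2 * Real.pi := by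
      rw [norm_mul, Complex.norm_I, mul_one, Complex.norm_mul, Complex.norm_real,
        Complex.norm_ofNat, Real.norm_eq_abs, abs_of_pos Real.pi_pos]
    rw [hden]
    have hnum : ‖(-(L : ℂ) / k) * (ℓ j : ℂ) + w j‖ ≤ (|(L : ℝ)| / k) * ℓ j + W := by
      refine (norm_add_le _ _).trans (add_le_add ?_ (hw j))
      rw [norm_mul, norm_div, norm_neg, Complex.norm_intCast, Complex.norm_natCast,
        Complex.norm_real, Real.norm_eq_abs, abs_of_nonneg (hℓ0 j)]
    rw [mul_comm (((N₀ + j : ℕ) : ℝ)) (2 * Real.pi)]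
    exact div_le_div_of_nonneg_right hnum (by positivity)
  -- `ε → 0`, so eventually `‖ε‖ ≤ 1/2` and `‖u⁻¹ − 1‖ ≤ 3‖ε‖`
  have hbt : Tendsto (fun j => ((|(L : ℝ)| / k) * ℓ j + W) / (2 * Real.pi * ((N₀ + j : ℕ) : ℝ)))
      atTop (𝓝 0) := by
    have h := (tendsto_log_label_div (|(L : ℝ)| / k) W).comp (tendsto_add_atTop_nat N₀)
    refine h.congr fun j => ?_
    simp only [Function.comp_apply, hℓ]
    rw [show j + N₀ = N₀ + j from Nat.add_comm _ _]
  have hεt : Tendsto (fun j => ‖ε j‖) atTop (𝓝 0) :=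
    squeeze_zero (fun j => norm_nonneg _) hεle hbt
  have hsmall : ∀ᶠ j in atTop, ‖ε j‖ ≤ 1 / 2 := by
    filter_upwards [Metric.tendsto_nhds.1 hεt (1 / 2) (by norm_num)] with j hj
    rw [Real.dist_eq, sub_zero, abs_of_nonneg (norm_nonneg _)] at hj
    exact hj.le
  have hkey : ∀ᶠ j in atTop, ‖(u j)⁻¹ - 1‖ ≤ 3 * ‖ε j‖ := by
    filter_upwards [hsmall] with j hj
    have hlog : ‖Complex.log (1 + ε j)‖ ≤ 3 / 2 * ‖ε j‖ := Complex.norm_log_one_add_half_le_self hj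
    have hlogk : ‖Complex.log (1 + ε j) / k‖ ≤ ‖Complex.log (1 + ε j)‖ := by
      rw [norm_div, Complex.norm_natCast]
      exact div_le_self (norm_nonneg _) hk1
    have hle1 : ‖Complex.log (1 + ε j) / k‖ ≤ 1 := by linarith
    rw [huinv j]
    calc ‖Complex.exp (Complex.log (1 + ε j) / k) - 1‖ ≤ 2 * ‖Complex.log (1 + ε j) / k‖ :=
          Complex.norm_exp_sub_one_le hle1
      _ ≤ 3 * ‖ε j‖ := by linarith
  -- conclude by comparison with `e^{dℓ/k}·3((|L|/k)ℓ + W)/(2πn)`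
  have hcmp := (tendsto_exp_pow_mul_div_label hN₀ hk hd (3 * (|(L : ℝ)| / k) / (2 * Real.pi))
    (3 * W / (2 * Real.pi)))
  refine squeeze_zero' (Eventually.of_forall fun j => by positivity) ?_ hcmp
  filter_upwards [hkey] with j hj
  have hnpos : (0 : ℝ) < ((N₀ + j : ℕ) : ℝ) := by linarith [hn1 j]
  have h3 : 3 * ‖ε j‖ ≤ (3 * (|(L : ℝ)| / k) / (2 * Real.pi) * ℓ j + 3 * W / (2 * Real.pi)) /
      ((N₀ + j : ℕ) : ℝ) := by
    have := hεle j
    calc 3 * ‖ε j‖ ≤ 3 * (((|(L : ℝ)| / k) * ℓ j + W) / (2 * Real.pi * ((N₀ + j : ℕ) : ℝ))) := by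
          linarith
      _ = _ := by field_simp
  exact mul_le_mul_of_nonneg_left (hj.trans h3) (by positivity)

/-! ## Part C. Polynomial perturbation -/

/-- `‖v^i − 1‖ ≤ (d + 1)·2^d·‖v − 1‖` for `‖v‖ ≤ 2`, `i ≤ d`. [folklore] -/
theorem norm_pow_sub_one_le {v : ℂ} (hv : ‖v‖ ≤ 2) {i d : ℕ} (hi : i ≤ d) :
    ‖v ^ i - 1‖ ≤ ((d : ℝ) + 1) * 2 ^ d * ‖v - 1‖ := by
  have hgeom : v ^ i - 1 = (∑ l ∈ Finset.range i, v ^ l) * (v - 1) := (geom_sum_mul v i).symm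
  rw [hgeom, norm_mul]
  refine mul_le_mul_of_nonneg_right ?_ (norm_nonneg _)
  calc ‖∑ l ∈ Finset.range i, v ^ l‖ ≤ ∑ l ∈ Finset.range i, ‖v ^ l‖ := norm_sum_le _ _
    _ ≤ ∑ _l ∈ Finset.range i, (2 : ℝ) ^ d := by
        refine Finset.sum_le_sum fun l hl => ?_
        rw [norm_pow]
        have hl' : l ≤ d := by have := Finset.mem_range.1 hl; omega
        calc ‖v‖ ^ l ≤ 2 ^ l := pow_le_pow_left₀ (norm_nonneg _) hv l
          _ ≤ 2 ^ d := pow_le_pow_right₀ (by norm_num) hl'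
    _ = i * 2 ^ d := by rw [Finset.sum_const, Finset.card_range, nsmul_eq_mul]
    _ ≤ ((d : ℝ) + 1) * 2 ^ d := by
        have : (i : ℝ) ≤ d + 1 := by
          have : (i : ℝ) ≤ d := by exact_mod_cast hi
          linarith
        exact mul_le_mul_of_nonneg_right this (by positivity)

/-- **Polynomial perturbation at a growing real scale**: `deg Q ≤ d`, `a_m ≥ 1` real, `‖v_m‖ ≤ 2`
eventually and `a_m^d·‖v_m − 1‖ → 0` ⟹ `Q(a_m v_m) − Q(a_m) → 0`. [folklore] -/
theorem tendsto_eval_mul_sub_eval (Q : ℂ[X]) {d : ℕ} (hQ : Q.natDegree ≤ d) {a : ℕ → ℝ}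
    (ha : ∀ m, 1 ≤ a m) {v : ℕ → ℂ} (hv : ∀ᶠ m in atTop, ‖v m‖ ≤ 2)
    (hrate : Tendsto (fun m => a m ^ d * ‖v m - 1‖) atTop (𝓝 0)) :
    Tendsto (fun m => Q.eval ((a m : ℂ) * v m) - Q.eval (a m : ℂ)) atTop (𝓝 0) := by
  classical
  set C : ℝ := (∑ i ∈ Finset.range (d + 1), ‖Q.coeff i‖) * (((d : ℝ) + 1) * 2 ^ d) with hC
  have hC0 : 0 ≤ C := by positivity
  rw [tendsto_zero_iff_norm_tendsto_zero]
  have hcmp : Tendsto (fun m => C * (a m ^ d * ‖v m - 1‖)) atTop (𝓝 0) := by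
    have := hrate.const_mul C
    rwa [mul_zero] at this
  refine squeeze_zero' (Eventually.of_forall fun m => norm_nonneg _) ?_ hcmp
  filter_upwards [hv] with m hvm
  have hdeg : Q.natDegree < d + 1 := by omega
  have ha0 : 0 ≤ a m := by linarith [ha m]
  rw [Polynomial.eval_eq_sum_range' hdeg, Polynomial.eval_eq_sum_range' hdeg, ← Finset.sum_sub_distrib]
  calc ‖∑ i ∈ Finset.range (d + 1), (Q.coeff i * ((a m : ℂ) * v m) ^ i - Q.coeff i * (a m : ℂ) ^ i)‖
      ≤ ∑ i ∈ Finset.range (d + 1), ‖Q.coeff i * ((a m : ℂ) * v m) ^ i - Q.coeff i * (a m : ℂ) ^ i‖ :=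
        norm_sum_le _ _
    _ ≤ ∑ i ∈ Finset.range (d + 1), ‖Q.coeff i‖ * (((d : ℝ) + 1) * 2 ^ d) * (a m ^ d * ‖v m - 1‖) := by
        refine Finset.sum_le_sum fun i hi => ?_
        have hid : i ≤ d := by have := Finset.mem_range.1 hi; omega
        have e : Q.coeff i * ((a m : ℂ) * v m) ^ i - Q.coeff i * (a m : ℂ) ^ i =
            Q.coeff i * (a m : ℂ) ^ i * (v m ^ i - 1) := by ring
        rw [e, norm_mul, norm_mul, norm_pow, Complex.norm_real, Real.norm_eq_abs, abs_of_nonneg ha0]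
        have h1 : a m ^ i ≤ a m ^ d := pow_le_pow_right₀ (ha m) hid
        have h2 := norm_pow_sub_one_le hvm hid
        calc ‖Q.coeff i‖ * a m ^ i * ‖v m ^ i - 1‖
            ≤ ‖Q.coeff i‖ * a m ^ d * (((d : ℝ) + 1) * 2 ^ d * ‖v m - 1‖) :=
              mul_le_mul (mul_le_mul_of_nonneg_left h1 (norm_nonneg _)) h2 (norm_nonneg _)
                (by positivity)
          _ = ‖Q.coeff i‖ * (((d : ℝ) + 1) * 2 ^ d) * (a m ^ d * ‖v m - 1‖) := by ring
    _ = C * (a m ^ d * ‖v m - 1‖) := by rw [hC, ← Finset.sum_mul, ← Finset.sum_mul]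

end Summit.Schanuel.Schanuel.Theorems

end
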